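import Summits.ResolutionOfSingularities.ResolutionOfSingularities.Theorems.PurelyInseparableDim4FreeTailLemma
import HarnessLib
import HarnessLib.Audit.Tags

/-!
# Purely inseparable dim 4 — consequences of FT(p, p): K2(3), the `ē ≡ 1` cone, F4-I(3,3) ⟺ E2(3,3)

With `FreeTailProof.noIsolatedFreeTailAt_self : FreeTail.NoIsolatedFreeTailAt p p` in the tree:

* `noIsolatedBandRun3` — **K2(3) = `FreeTail.NoIsolatedBandRun3` holds unconditionally** (FT(3,3) +
  p-9's `FreeTail.shapeLemma3`, assembled by `FreeTail.noIsolatedBandRun3_of_charP`): over a field of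
  characteristic `3` there is no infinite `Step0 3` chain of ISOLATED `3`-fold states all of residual
  order `4` — the BAND half of F4-I(3,3).
* `no_isolated_cone_chain_one` — no infinite isolated `Step0 p` chain on the cone with `ē ≡ 1`
  (frame form of [CJS 2020] Cor. 5.37), every prime `p`.
* **`noIsolatedTrap_three_three_iff_coneTwo` — `NoIsolatedTrap 3 3 ⟺ E2(3,3)`**: the crux F4-I(3,3)
  is now EQUIVALENT to «no infinite isolated `Step0 3` chain all of whose states have `ord₀ F = 3` and
  `dim_K A(F_3) = 2`» — the `e = ē = 2` cone, the exact territory of [CJS 2020] Thm. 5.40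
  (LNM 2270 Thm. 6.40, hypotheses (F1)–(F3) p. 103).

OURS; nothing here proves E2(3,3), `NoIsolatedTrap 3 3`, or resolution in dimension `≥ 4` /
characteristic `p`.  Supports stmt-ResolutionOfSingularities-16155 (helper).
-/

set_option linter.dupNamespace false -- mandated namespace of this single-conjunct summit

namespace Summit.ResolutionOfSingularities.ResolutionOfSingularities.Theorems.PIDim4

namespace FreeTailProof

open MvPolynomial Finset
open Literature.AlgebraicGeometry.Resolution
open Literature.AlgebraicGeometry.Resolution.Hauser2010
open Literature.AlgebraicGeometry.Resolution.HauserPerlega2019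
open PointBlowup (additiveSubspace)

variable {K : Type} [Field K]

/-! ## Consequences at `(p, q) = (3, 3)` and on the cone -/

/-- **K2(3) = `NoIsolatedBandRun3`, unconditionally** (FT(3,3) + p-9's `shapeLemma3`). [OURS] -/
theorem noIsolatedBandRun3 : FreeTail.NoIsolatedBandRun3 :=
  FreeTail.noIsolatedBandRun3_of_charP (noIsolatedFreeTailAt_self 3) FreeTail.shapeLemma3

/-- **No isolated cone chain with `ē ≡ 1`** (the frame form of [CJS 2020] Cor. 5.37), now
unconditional: FT(p,p) + `IsolatedBand.no_isolated_cone_chain_one_of_freeTail`.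
[OURS] [cite: CossartJannsenSaito2020, Cor. 5.37] -/
theorem no_isolated_cone_chain_one (p : ℕ) [Fact p.Prime] [CharP K p] [DecidableEq K]
    {c : ℕ → State K} (hc : ∀ k, IsIsolated p (c k).F ∧ Step0 p (c k) (c (k + 1))) {k₀ : ℕ}
    (hk₀ : 1 ≤ k₀) (hord : ordZero (c k₀).F = p)
    (he : ∀ k, k₀ ≤ k → Module.finrank K (additiveSubspace (initialForm (c k).F)) = 1) : False :=
  IsolatedBand.no_isolated_cone_chain_one_of_freeTail p (noIsolatedFreeTailAt_self p) hc hk₀ hord he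

/-- **F4-I(3,3) ⟺ E2(3,3)**: `NoIsolatedTrap 3 3` holds iff there is no infinite isolated `Step0 3`
chain all of whose states have `ord₀ F = 3` and `dim_K A(F_3) = 2` — the `e = ē = 2` cone, the exact
territory of [CJS 2020] Thm. 5.40 (LNM 2270 Thm. 6.40).  (`IsolatedBand.noIsolatedTrap_three_three_iff_freeTail_and_coneTwo`
with FT(3,3) discharged.) [OURS] [cite: CossartJannsenSaito2020, Thm. 5.40] -/
theorem noIsolatedTrap_three_three_iff_coneTwo :
    NoIsolatedTrap 3 3 ↔ ∀ (K : Type) [Field K] [CharP K 3] [DecidableEq K],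
      ¬ ∃ c : ℕ → State K, ∀ k, IsIsolated 3 (c k).F ∧ Step0 3 (c k) (c (k + 1)) ∧
        ordZero (c k).F = (3 : ℕ∞) ∧ Module.finrank K (additiveSubspace (initialForm (c k).F)) = 2 :=
  ⟨fun h => (IsolatedBand.freeTail_and_coneTwo_of_noIsolatedTrap_three_three h).2,
    fun h => IsolatedBand.noIsolatedTrap_three_three_of_freeTail_and_coneTwo
      (noIsolatedFreeTailAt_self 3) h⟩

end FreeTailProof

end Summit.ResolutionOfSingularities.ResolutionOfSingularities.Theorems.PIDim4
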